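/-
Copyright: the b2b-balaban T⁴-continuum CRUX team, row NE7b OWNER lineage `t4-ne7b-p1` (gen 141). Project licence.
-/
import Summits.QuantumFields.BalabanUV.T4Continuum.Spine.NE7b.SupBlockThirdCentredSplit
import Summits.QuantumFields.BalabanUV.T4Continuum.Spine.NE7b.SupBlockThirdKernelAverage
import Summits.QuantumFields.BalabanUV.T4Continuum.Spine.NE7b.SupWhitenedHessianGradientCovariance
import Summits.QuantumFields.BalabanUV.T4Continuum.Spine.NE7b.SupWhitenedGradientHessianCovariance
import Summits.QuantumFields.BalabanUV.T4Continuum.Spine.NE7b.SupWhitenedThirdCumulantKernelLetter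

/-!
# THE THIRD-ORDER KERNEL LETTER OF THE FLUCTUATION STEP, ASSEMBLED, FOR A GENERAL `Γ = AAᵀ` (SCOPING (d12)(1)(iv)).  With `T(ψ)` the
# third Fréchet derivative of the next potential `W(ψ) = −log∫e^{−U(ω+ψ)}dN(0,AAᵀ)(ω)` ((419)'s trilinear map, WRITTEN OUT), the centred
# display (472) `T(ψ)[h,k,l] = Z⁻¹∫e^{−U}[C − (A_k−a_k)B_hl − B_hk(A_l−a_l) − (A_h−a_h)B_kl + (A_h−a_h)(A_k−a_k)(A_l−a_l)]` splits
# `T(ψ)[e_x,e_y,e_z]` into FIVE tilted pieces — the average `⟨U‴⟩_{xyz}`, three two-point covariances `Cov(B_xz,A_y)`, `Cov(B_xy,A_z)`,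
# `Cov(A_x,B_yz)` and the third cumulant `κ₃(A_x,A_y,A_z)` — whose double row sums are (470), (469) (twice, `y ↔ z` by `Finset.sum_comm`),
# (473) and (468) (bridged from the whitened Lebesgue format to `N(0,AAᵀ)` by (457)'s pushforward identities); so, under the block class
# letters (`κ₃` and the third row∕column letters `κ₃r`, `k3r`, `k3c` of the majorant `K3`; the Hessian majorant `Hk` with `hr`, `hc`), the
# factor's letters (`αr`, `αc`, `lamA < 1`), the smallness `γ, γ′ < 1`, the two regulators, the secant letter `λγ_op < 1` and the WEIGHTED
# letters of (468) (`γθ, γθ′ < 1`, `αθ`, `βθ`, `S`):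
#   `Σ_y Σ_z |T(ψ)[e_x,e_y,e_z]| ≤ κ₃r + (2·αr·k3r·αc·hc + hr·αr·αc·k3c)·(1−γ)⁻¹(1−γ′)⁻¹∕(1−lamA) + 4√(m₄K)·S²`
# UNIFORMLY IN THE BACKGROUND `ψ` AND THE VOLUME, for the road's SINGULAR finite-range `Γ = AAᵀ` — NO precision condition (row NE7b, node U5c;
# (468)∕(469)∕(470)∕(472)∕(473), (457), (458) BY NAME; [folklore])

Cell `pub-balaban`, sub-cell `t4`, spine estimate NE7b (`T4WeightBudget.RelWeightBound`; the cell's OWN estimate — NOT PRINTED in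
[Bałaban 1983–89], NOT PROVED).  Crux-route work under `Spine/NE7b/` by the row OWNER (`t4-ne7b-p1` gen 141, file (475)) under FREEZE
(0)'s crux-prover clause; NOTHING of Bałaban's is named as a Lean object, valued or asserted; no `T4Continuum/Support` leaf typed; no
`def`, no notation (`T(ψ)` WRITTEN OUT as in (419)∕(472)); zero `sorry`.  Imports (BY NAME): the OWNER's (474) `…SupBlockThirdCentredSplit`
(`centred_split`; through it (472) `hessW_deriv_apply_centred`, (471), (419), (423), (401), (403)),
(470) `…SupBlockThirdKernelAverage` (`tilted_third_average_rowsum`), (469) `…SupWhitenedHessianGradientCovariance`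
(`whitened_hessgrad_cov_kernel_letter`), (473) `…SupWhitenedGradientHessianCovariance` (`whitened_gradhess_cov_kernel_letter`), (468)
`…SupWhitenedThirdCumulantKernelLetter` (`whitened_third_cumulant_kernel_letter`); through them (457) `whitened_tilted_eq_gauss`,
`whitened_integral_eq` and (458) `posSemidef_AAT`.

WHAT IS PROVED ([folklore]):
* §1 the BRIDGES `whitened_mean_bridge` (`E_νF_v = Z⁻¹∫e^{−U}A_v dN(0,AAᵀ)`) and `whitened_triple_bridge` (the centred
  triple product, any centring constants) from (468)'s whitened Lebesgue format to `N(0,AAᵀ)` ((457)'s `whitened_tilted_eq_gauss`,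
  `whitened_integral_eq`).
* §2 THE END **`whitened_third_kernel_letter`** ((472)'s centred display at `(e_x,e_y,e_z)`, (474)'s split, the five letters, `Σ|·|`
  sub-additivity); §3 toy.

HONEST (what this is NOT).  Letters: the double row sum of the output's third kernel is bounded by the input's third-order letters and the
factor's letters, for general `Γ = AAᵀ`; the GEOMETRY letters (`γθ, γθ′, αθ, βθ, S`; `αr, αc`) are NOT discharged for the road's finite-range
factor ((d12)(2), successor); orders four and five ((d12)(3)) and the kernel-letter class map ((d12)(4)) are NOT typed; scalar skeleton
((A3), NC-NE7b-α UNRULED); nothing of Bałaban's asserted.  BY-NAME EFFECT ON THE WALL: NONE.  NE7b NOT PRINTED ∕ NOT PROVED; spine PROVED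
0∕9; rung (B)+1 — the programme's measures remain FINITE-torus statements; NOT the mass gap, NOT Clay.  HONEST DEPENDENCY: continuum YM on
T⁴ ⇐ BetaPertH ∧ nine spine estimates (0∕9 proved); BetaPertH ⇐ (D1) ∧ (D4) ∧ CAP+tail; G-an2-4 gates asym, D1 and NE2∕3∕4.
-/

set_option autoImplicit false
set_option maxSynthPendingDepth 3

noncomputable section

namespace Summit.QuantumFields.BalabanUV.T4Continuum.NE7b.SupWhitenedThirdKernelLetter

open MeasureTheory ProbabilityTheory Finset Real Matrix
open scoped BigOperators Matrix
open Literature.Probability.Distributions (matrixCLM)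
open SupEffectiveActionDerivative (mul_opBound_le_of_le)
open SupWhitenedMomentLetters (posSemidef_AAT)
open SupWhitenedCovarianceKernelLetter (whitened_tilted_eq_gauss whitened_integral_eq)
open SupBlockThirdCentredGeneral (hessW_deriv_apply_centred)
open SupBlockThirdCentredSplit (centred_split)
open SupBlockThirdKernelAverage (tilted_third_average_rowsum)
open SupWhitenedHessianGradientCovariance (whitened_hessgrad_cov_kernel_letter)
open SupWhitenedGradientHessianCovariance (whitened_gradhess_cov_kernel_letter)
open SupWhitenedThirdCumulantKernelLetter (whitened_third_cumulant_kernel_letter)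

variable {ι κ : Type} [Fintype ι] [DecidableEq ι] [Fintype κ] [DecidableEq κ]

/-! ## §1. The bridges from the whitened Lebesgue format to `N(0,AAᵀ)` -/

section Bridges

variable {U : EuclideanSpace ℝ ι → ℝ} {U' : EuclideanSpace ℝ ι → EuclideanSpace ℝ ι →L[ℝ] ℝ}

/-- **The mean bridge**: the tilted whitened mean of a gradient component is the tilted Gaussian mean under `N(0,AAᵀ)`:
`E_νF_v = Z⁻¹∫e^{−U(ω+ψ)}U′(ω+ψ)[v] dN(0,AAᵀ)(ω)` ((457)'s `whitened_tilted_eq_gauss` and the pushforward `whitened_integral_eq`). [folklore] -/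
theorem whitened_mean_bridge (hUc : Continuous U) (hU'c : Continuous U') (A : Matrix ι κ ℝ) (ψ v : EuclideanSpace ℝ ι) :
    ∫ w, U' (matrixCLM A (WithLp.toLp 2 w) + ψ) v ∂((volume : Measure (κ → ℝ)).tilted fun z => -(1 / 2 * (z ⬝ᵥ z) + U (matrixCLM A (WithLp.toLp 2 z)
        + ψ))) =
      (∫ ω : EuclideanSpace ℝ ι, exp (-U (ω + ψ)) ∂(multivariateGaussian 0 (A * Aᵀ)))⁻¹ * (∫ ω : EuclideanSpace ℝ ι, exp (-U (ω + ψ)) * U' (ω + ψ) v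
          ∂(multivariateGaussian 0 (A * Aᵀ))) := by
  have hsh : Continuous fun ω : EuclideanSpace ℝ ι => ω + ψ := continuous_id.add continuous_const
  have he : Continuous fun ω : EuclideanSpace ℝ ι => exp (-U (ω + ψ)) := continuous_exp.comp (hUc.comp hsh).neg
  have hg : Continuous fun ω : EuclideanSpace ℝ ι => U' (ω + ψ) v := (hU'c.comp hsh).clm_apply continuous_const
  have hm : AEStronglyMeasurable (fun ω : EuclideanSpace ℝ ι => exp (-U (ω + ψ)) * U' (ω + ψ) v) (multivariateGaussian 0 (A * Aᵀ)) :=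
    (he.mul hg).aestronglyMeasurable
  rw [whitened_tilted_eq_gauss A ψ]
  simp only [WithLp.toLp_ofLp]
  rw [whitened_integral_eq A he.aestronglyMeasurable, whitened_integral_eq A hm, div_eq_inv_mul]

/-- **The triple bridge**: for any centring constants `c_h, c_k, c_l`,
`E_ν(F_h−c_h)(F_k−c_k)(F_l−c_l) = Z⁻¹∫e^{−U}(A_h−c_h)(A_k−c_k)(A_l−c_l) dN(0,AAᵀ)`. [folklore] -/
theorem whitened_triple_bridge (hUc : Continuous U) (hU'c : Continuous U') (A : Matrix ι κ ℝ) (ψ h k l : EuclideanSpace ℝ ι) (ch ck cl : ℝ) :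
    ∫ w, (U' (matrixCLM A (WithLp.toLp 2 w) + ψ) h - ch) * (U' (matrixCLM A (WithLp.toLp 2 w) + ψ) k - ck) * (U' (matrixCLM A (WithLp.toLp 2 w) + ψ)
        l - cl) ∂((volume : Measure (κ → ℝ)).tilted fun z => -(1 / 2 * (z ⬝ᵥ z) + U (matrixCLM A (WithLp.toLp 2 z) + ψ))) =
      (∫ ω : EuclideanSpace ℝ ι, exp (-U (ω + ψ)) ∂(multivariateGaussian 0 (A * Aᵀ)))⁻¹ * (∫ ω : EuclideanSpace ℝ ι, exp (-U (ω + ψ)) * ((U' (ω + ψ)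
          h - ch) * (U' (ω + ψ) k - ck) * (U' (ω + ψ) l - cl))
        ∂(multivariateGaussian 0 (A * Aᵀ))) := by
  have hsh : Continuous fun ω : EuclideanSpace ℝ ι => ω + ψ := continuous_id.add continuous_const
  have he : Continuous fun ω : EuclideanSpace ℝ ι => exp (-U (ω + ψ)) := continuous_exp.comp (hUc.comp hsh).neg
  have hg : ∀ v : EuclideanSpace ℝ ι, Continuous fun ω : EuclideanSpace ℝ ι => U' (ω + ψ) v := fun v => (hU'c.comp hsh).clm_apply continuous_const
  have hP : Continuous fun ω : EuclideanSpace ℝ ι => exp (-U (ω + ψ)) * ((U' (ω + ψ) h - ch) * (U' (ω + ψ) k - ck) * (U' (ω + ψ) l - cl)) :=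
    he.mul ((((hg h).sub continuous_const).mul ((hg k).sub continuous_const)).mul ((hg l).sub continuous_const))
  rw [whitened_tilted_eq_gauss A ψ]
  simp only [WithLp.toLp_ofLp]
  rw [whitened_integral_eq A he.aestronglyMeasurable, whitened_integral_eq A hP.aestronglyMeasurable, div_eq_inv_mul]

end Bridges

/-! ## §2. THE END: the third-order kernel letter for `Γ = AAᵀ` -/

section TheEnd

variable {U : EuclideanSpace ℝ ι → ℝ} {U' : EuclideanSpace ℝ ι → EuclideanSpace ℝ ι →L[ℝ] ℝ}
  {U'' : EuclideanSpace ℝ ι → EuclideanSpace ℝ ι →L[ℝ] EuclideanSpace ℝ ι →L[ℝ] ℝ}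
  {U₃ : EuclideanSpace ℝ ι → EuclideanSpace ℝ ι →L[ℝ] EuclideanSpace ℝ ι →L[ℝ] EuclideanSpace ℝ ι →L[ℝ] ℝ} {Hk : ι → ι → ℝ} {K3 : ι → ι → ι → ℝ}
  {A : Matrix ι κ ℝ} {γop κ₀ κ₁ κ₂ κ₃ κ₃r a τ δ θp lam lamA αr αc hr hc k3r k3c γ γ' γθ γθ' αθ βθ S : ℝ} {θ : κ → κ → ℝ} {σ : ι → κ → ℝ}
  {ρ : ι → ι → ℝ}

/-- **THE END — THE THIRD-ORDER KERNEL LETTER OF THE FLUCTUATION STEP, GENERAL `Γ = AAᵀ`.**  For the `C³` block class (stability `κ₀` on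
`Y`, gradient letter `κ₁, a`, `‖U″‖ ≤ κ₂`, `‖U‴‖ ≤ κ₃`, the secant letter `λ`, the Hessian majorant `Hk ≥ 0` with row∕column letters `hr, hc`,
the third majorant `K3 ≥ 0` with the third row letter `κ₃r` of `U‴` itself and the letters `k3r` (`Σ_yΣ_uK3_{xyu}`), `k3c` (`Σ_{y,z}K3_{yzu}`)),
the factor `A` (`Γ = AAᵀ ⪯ γ_op·1`; `ℓ¹` letters `αr, αc`; diagonal letter `lamA < 1`), the two regulators, `λγ_op < 1`, the smallness
`αc·hr·αr∕(1−lamA) ≤ γ < 1`, `αc·hc·αr∕(1−lamA) ≤ γ′ < 1`, and (468)'s weighted letters (`θ, σ, ρ`; `γθ, γθ′ < 1`, `αθ`, `βθ`, `Σ_yρ_{xy}⁻¹ ≤ S`):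
`Σ_y Σ_z |T(ψ)[e_x,e_y,e_z]| ≤ κ₃r + (2·αr·k3r·(αc·hc) + hr·αr·(αc·k3c))·(1−γ)⁻¹(1−γ′)⁻¹∕(1−lamA) + 4√(m₄K)·S²`,
`m₄ = 5κ₂⁴γ_op²∕(1−λγ_op)²`, `K = αθ(1−γθ)⁻¹βθ(1−γθ′)⁻¹∕(1−lamA)` — uniformly in the background `ψ` and the volume. [folklore] -/
theorem whitened_third_kernel_letter [Nonempty κ] (hΓop : (γop • (1 : Matrix ι ι ℝ) - A * Aᵀ).PosSemidef) (Y : Finset ι)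
    (hUd : ∀ φ : EuclideanSpace ℝ ι, HasFDerivAt U (U' φ) φ) (hU'd : ∀ φ : EuclideanSpace ℝ ι, HasFDerivAt U' (U'' φ) φ)
    (hU''d : ∀ φ : EuclideanSpace ℝ ι, HasFDerivAt U'' (U₃ φ) φ) (hU₃c : Continuous U₃) (hκ₀ : 0 ≤ κ₀) (hκ₁ : 0 ≤ κ₁) (ha : 0 ≤ a) (hκ₂ : 0 ≤ κ₂)
        (hκ₃ : 0 ≤ κ₃)
    (hτ : 0 < τ) (hδ : 0 < δ) (hθ0 : 0 < θp) (hθ1 : θp < 1) (hκθ : (2 * κ₀ * (1 + τ) + 4 * δ) * γop ≤ θp) (hκθw : 2 * κ₀ * (1 + τ) * γop + 4 * δ ≤ θp)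
    (hstab : ∀ φ : EuclideanSpace ℝ ι, -(κ₀ * ∑ x ∈ Y, φ x ^ 2) ≤ U φ)
    (hU'b : ∀ φ : EuclideanSpace ℝ ι, ‖U' φ‖ ≤ κ₁ * (a + ∑ x ∈ Y, φ x ^ 2)) (hU''b : ∀ φ : EuclideanSpace ℝ ι, ‖U'' φ‖ ≤ κ₂)
    (hU₃b : ∀ φ : EuclideanSpace ℝ ι, ‖U₃ φ‖ ≤ κ₃) (hlam : 0 ≤ lam)
    (hUsec : ∀ s : ℝ, 0 ≤ s → s ≤ 1 → ∀ a b : EuclideanSpace ℝ ι,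
      U ((1 - s) • a + s • b) - lam / 2 * (s * (1 - s)) * ∑ i, (a i - b i) ^ 2 ≤ (1 - s) * U a + s * U b)
    (hρg : lam * γop < 1)
    -- the majorants and their letters
    (hHk : ∀ (φ : EuclideanSpace ℝ ι) (x z : ι), |U'' φ (EuclideanSpace.single z (1 : ℝ)) (EuclideanSpace.single x (1 : ℝ))| ≤ Hk x z)
    (hHk0 : ∀ v u, 0 ≤ Hk v u)
    (hK3 : ∀ (φ : EuclideanSpace ℝ ι) (u x y : ι),
      |U₃ φ (EuclideanSpace.single u (1 : ℝ)) (EuclideanSpace.single x (1 : ℝ)) (EuclideanSpace.single y (1 : ℝ))| ≤ K3 x y u)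
    (hK30 : ∀ x y u, 0 ≤ K3 x y u)
    (hU₃row : ∀ (φ : EuclideanSpace ℝ ι) (x : ι), ∑ y, ∑ z, |U₃ φ (EuclideanSpace.single x (1 : ℝ)) (EuclideanSpace.single y (1 : ℝ))
        (EuclideanSpace.single z (1 : ℝ))| ≤ κ₃r)
    (hhr : ∀ v, ∑ u, Hk v u ≤ hr) (hhc : ∀ u, ∑ v, Hk v u ≤ hc) (hk3r : ∀ x, ∑ y, ∑ u, K3 x y u ≤ k3r) (hk3c : ∀ u, ∑ y, ∑ z, K3 y z u ≤ k3c)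
    -- the factor's letters and the smallness
    (ψ : EuclideanSpace ℝ ι) (hαr : ∀ u, ∑ w, |A u w| ≤ αr) (hαc : ∀ w, ∑ u, |A u w| ≤ αc)
    (hlamA : ∀ x : κ, ∑ u, ∑ v, |A u x| * |A v x| * Hk v u ≤ lamA) (hlamA1 : lamA < 1)
    (hγ : αc * hr * αr / (1 - lamA) ≤ γ) (hγ1 : γ < 1) (hγ' : αc * hc * αr / (1 - lamA) ≤ γ') (hγ'1 : γ' < 1)
    -- the weights ((468))
    (hθw1 : ∀ x z, 1 ≤ θ x z) (hθdiag : ∀ x, θ x x = 1) (hθmul : ∀ x y z, θ x z ≤ θ x y * θ y z)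
    (hσ0 : ∀ x w, 0 ≤ σ x w) (hσθ : ∀ x z w, σ x w ≤ σ x z * θ z w)
    (hρ1 : ∀ x y, 1 ≤ ρ x y) (hρsymm : ∀ x y, ρ x y = ρ y x) (hρmul : ∀ x y z, ρ x z ≤ ρ x y * ρ y z) (hρσ : ∀ x y w, ρ x y ^ 8 ≤ σ x w * σ y w)
    -- the weighted letters ((468))
    (hCθ : ∀ x : κ, ∑ w, (if w = x then 0 else ∑ u, ∑ v, |A u w| * |A v x| * Hk v u) / (1 - lamA) * θ x w ≤ γθ) (hγθ1 : γθ < 1)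
    (hCθc : ∀ w : κ, ∑ x, (if w = x then 0 else ∑ u, ∑ v, |A u w| * |A v x| * Hk v u) / (1 - lamA) * θ x w ≤ γθ') (hγθ'1 : γθ' < 1)
    (haσ : ∀ v : ι, ∑ w, (∑ u, |A u w| * Hk v u) * σ v w ≤ αθ) (hβ : 0 ≤ βθ) (haσ' : ∀ (v : ι) (w : κ), (∑ u, |A u w| * Hk v u) * σ v w ≤ βθ)
    (x : ι) (hS : ∑ y, 1 / ρ x y ≤ S) :
    ∑ y, ∑ z, |(((∫ ω : EuclideanSpace ℝ ι, exp (-U (ω + ψ)) ∂(multivariateGaussian 0 (A * Aᵀ)))⁻¹ • (∫ ω : EuclideanSpace ℝ ι, (exp (-U (ω + ψ)) •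
        (U₃ (ω + ψ) -
        (((ContinuousLinearMap.smulRightL ℝ (EuclideanSpace ℝ ι) (EuclideanSpace ℝ ι →L[ℝ] ℝ)) (U' (ω + ψ))).comp (U'' (ω + ψ)) +
            (((ContinuousLinearMap.smulRightL ℝ
        (EuclideanSpace ℝ ι) (EuclideanSpace ℝ ι →L[ℝ] ℝ))).comp (U'' (ω + ψ))).flip (U' (ω + ψ)))) + (exp (-U (ω + ψ)) • -U' (ω + ψ)).smulRight (U''
            (ω + ψ) - (U' (ω +
        ψ)).smulRight (U' (ω + ψ)))) ∂(multivariateGaussian 0 (A * Aᵀ))) + ((-((∫ ω : EuclideanSpace ℝ ι, exp (-U (ω + ψ)) ∂(multivariateGaussian 0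
            (A * Aᵀ))) ^ 2)⁻¹) • -(∫ ω :
        EuclideanSpace ℝ ι, exp (-U (ω + ψ)) • U' (ω + ψ) ∂(multivariateGaussian 0 (A * Aᵀ)))).smulRight (∫ ω : EuclideanSpace ℝ ι, exp (-U (ω + ψ))
            • (U'' (ω + ψ) - (U' (ω +
        ψ)).smulRight (U' (ω + ψ))) ∂(multivariateGaussian 0 (A * Aᵀ)))) + (((ContinuousLinearMap.smulRightL ℝ (EuclideanSpace ℝ ι) (EuclideanSpace ℝ
            ι →L[ℝ] ℝ)) (((∫ ω :
        EuclideanSpace ℝ ι, exp (-U (ω + ψ)) ∂(multivariateGaussian 0 (A * Aᵀ))) ^ 2)⁻¹ • (∫ ω : EuclideanSpace ℝ ι, exp (-U (ω + ψ)) • U' (ω + ψ)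
            ∂(multivariateGaussian 0
        (A * Aᵀ))))).comp (∫ ω : EuclideanSpace ℝ ι, exp (-U (ω + ψ)) • (U'' (ω + ψ) - (U' (ω + ψ)).smulRight (U' (ω + ψ))) ∂(multivariateGaussian 0
            (A * Aᵀ))) +
        (((ContinuousLinearMap.smulRightL ℝ (EuclideanSpace ℝ ι) (EuclideanSpace ℝ ι →L[ℝ] ℝ))).comp (((∫ ω : EuclideanSpace ℝ ι, exp (-U (ω + ψ))
            ∂(multivariateGaussian 0
        (A * Aᵀ))) ^ 2)⁻¹ • (∫ ω : EuclideanSpace ℝ ι, exp (-U (ω + ψ)) • (U'' (ω + ψ) - (U' (ω + ψ)).smulRight (U' (ω + ψ))) ∂(multivariateGaussian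
            0 (A * Aᵀ))) + ((-2 / (∫ ω :
        EuclideanSpace ℝ ι, exp (-U (ω + ψ)) ∂(multivariateGaussian 0 (A * Aᵀ))) ^ 3) • -(∫ ω : EuclideanSpace ℝ ι, exp (-U (ω + ψ)) • U' (ω + ψ)
            ∂(multivariateGaussian 0
        (A * Aᵀ)))).smulRight (∫ ω : EuclideanSpace ℝ ι, exp (-U (ω + ψ)) • U' (ω + ψ) ∂(multivariateGaussian 0 (A * Aᵀ))))).flip (∫ ω :
            EuclideanSpace ℝ ι, exp (-U (ω + ψ)) • U' (ω
        + ψ) ∂(multivariateGaussian 0 (A * Aᵀ))))) (EuclideanSpace.single x (1 : ℝ)) (EuclideanSpace.single y (1 : ℝ)) (EuclideanSpace.single z (1 :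
            ℝ))| ≤
      κ₃r + (2 * (αr * k3r * (αc * hc)) + hr * αr * (αc * k3c)) * (1 - γ)⁻¹ * (1 - γ')⁻¹ / (1 - lamA) +
        4 * Real.sqrt (5 * (κ₂ ^ 4 * γop ^ 2) / (1 - lam * γop) ^ 2 * (αθ * (1 - γθ)⁻¹ * (βθ * (1 - γθ')⁻¹) / (1 - lamA))) * S ^ 2 := by
  have hΓ : (A * Aᵀ).PosSemidef := posSemidef_AAT A
  have hUc : Continuous U := continuous_iff_continuousAt.2 fun φ => (hUd φ).continuousAt
  have hU'c : Continuous U' := continuous_iff_continuousAt.2 fun φ => (hU'd φ).continuousAt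
  have hU''c : Continuous U'' := continuous_iff_continuousAt.2 fun φ => (hU''d φ).continuousAt
  have hκθ' : 2 * κ₀ * (1 + τ) * γop ≤ θp := mul_opBound_le_of_le (by positivity) (by linarith) hθ0.le hκθ
  -- Step 1: every summand is the five-piece split of the centred display ((472) + (474))
  have hT : ∀ y z : ι, (((∫ ω : EuclideanSpace ℝ ι, exp (-U (ω + ψ)) ∂(multivariateGaussian 0 (A * Aᵀ)))⁻¹ • (∫ ω : EuclideanSpace ℝ ι, (exp (-U (ω +
      ψ)) • (U₃ (ω + ψ) -
        (((ContinuousLinearMap.smulRightL ℝ (EuclideanSpace ℝ ι) (EuclideanSpace ℝ ι →L[ℝ] ℝ)) (U' (ω + ψ))).comp (U'' (ω + ψ)) +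
            (((ContinuousLinearMap.smulRightL ℝ
        (EuclideanSpace ℝ ι) (EuclideanSpace ℝ ι →L[ℝ] ℝ))).comp (U'' (ω + ψ))).flip (U' (ω + ψ)))) + (exp (-U (ω + ψ)) • -U' (ω + ψ)).smulRight (U''
            (ω + ψ) - (U' (ω +
        ψ)).smulRight (U' (ω + ψ)))) ∂(multivariateGaussian 0 (A * Aᵀ))) + ((-((∫ ω : EuclideanSpace ℝ ι, exp (-U (ω + ψ)) ∂(multivariateGaussian 0
            (A * Aᵀ))) ^ 2)⁻¹) • -(∫ ω :
        EuclideanSpace ℝ ι, exp (-U (ω + ψ)) • U' (ω + ψ) ∂(multivariateGaussian 0 (A * Aᵀ)))).smulRight (∫ ω : EuclideanSpace ℝ ι, exp (-U (ω + ψ))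
            • (U'' (ω + ψ) - (U' (ω +
        ψ)).smulRight (U' (ω + ψ))) ∂(multivariateGaussian 0 (A * Aᵀ)))) + (((ContinuousLinearMap.smulRightL ℝ (EuclideanSpace ℝ ι) (EuclideanSpace ℝ
            ι →L[ℝ] ℝ)) (((∫ ω :
        EuclideanSpace ℝ ι, exp (-U (ω + ψ)) ∂(multivariateGaussian 0 (A * Aᵀ))) ^ 2)⁻¹ • (∫ ω : EuclideanSpace ℝ ι, exp (-U (ω + ψ)) • U' (ω + ψ)
            ∂(multivariateGaussian 0
        (A * Aᵀ))))).comp (∫ ω : EuclideanSpace ℝ ι, exp (-U (ω + ψ)) • (U'' (ω + ψ) - (U' (ω + ψ)).smulRight (U' (ω + ψ))) ∂(multivariateGaussian 0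
            (A * Aᵀ))) +
        (((ContinuousLinearMap.smulRightL ℝ (EuclideanSpace ℝ ι) (EuclideanSpace ℝ ι →L[ℝ] ℝ))).comp (((∫ ω : EuclideanSpace ℝ ι, exp (-U (ω + ψ))
            ∂(multivariateGaussian 0
        (A * Aᵀ))) ^ 2)⁻¹ • (∫ ω : EuclideanSpace ℝ ι, exp (-U (ω + ψ)) • (U'' (ω + ψ) - (U' (ω + ψ)).smulRight (U' (ω + ψ))) ∂(multivariateGaussian
            0 (A * Aᵀ))) + ((-2 / (∫ ω :
        EuclideanSpace ℝ ι, exp (-U (ω + ψ)) ∂(multivariateGaussian 0 (A * Aᵀ))) ^ 3) • -(∫ ω : EuclideanSpace ℝ ι, exp (-U (ω + ψ)) • U' (ω + ψ)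
            ∂(multivariateGaussian 0
        (A * Aᵀ)))).smulRight (∫ ω : EuclideanSpace ℝ ι, exp (-U (ω + ψ)) • U' (ω + ψ) ∂(multivariateGaussian 0 (A * Aᵀ))))).flip (∫ ω :
            EuclideanSpace ℝ ι, exp (-U (ω + ψ)) • U' (ω
        + ψ) ∂(multivariateGaussian 0 (A * Aᵀ))))) (EuclideanSpace.single x (1 : ℝ)) (EuclideanSpace.single y (1 : ℝ)) (EuclideanSpace.single z (1 :
            ℝ)) =
      (∫ ω : EuclideanSpace ℝ ι, exp (-U (ω + ψ)) ∂(multivariateGaussian 0 (A * Aᵀ)))⁻¹ * (∫ ω : EuclideanSpace ℝ ι, exp (-U (ω + ψ)) * U₃ (ω + ψ)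
          (EuclideanSpace.single x (1 : ℝ)) (EuclideanSpace.single y (1 : ℝ)) (EuclideanSpace.single z (1 : ℝ)) ∂(multivariateGaussian 0 (A * Aᵀ))) -
          ((∫ ω : EuclideanSpace ℝ ι, exp (-U (ω + ψ)) ∂(multivariateGaussian 0 (A * Aᵀ)))⁻¹ * (∫ ω : EuclideanSpace ℝ ι, exp (-U (ω + ψ)) * (U'' (ω
          + ψ) (EuclideanSpace.single x (1 : ℝ)) (EuclideanSpace.single z (1 : ℝ)) * U' (ω + ψ) (EuclideanSpace.single y (1 : ℝ)))
          ∂(multivariateGaussian 0 (A * Aᵀ))) - ((∫ ω : EuclideanSpace ℝ ι, exp (-U (ω + ψ)) ∂(multivariateGaussian 0 (A * Aᵀ))) ^ 2)⁻¹ * ((∫ ω :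
          EuclideanSpace ℝ ι, exp (-U (ω + ψ)) * U'' (ω + ψ) (EuclideanSpace.single x (1 : ℝ)) (EuclideanSpace.single z (1 : ℝ))
          ∂(multivariateGaussian 0 (A * Aᵀ))) * (∫ ω : EuclideanSpace ℝ ι, exp (-U (ω + ψ)) * U' (ω + ψ) (EuclideanSpace.single y (1 : ℝ))
          ∂(multivariateGaussian 0 (A * Aᵀ))))) - ((∫ ω : EuclideanSpace ℝ ι, exp (-U (ω + ψ)) ∂(multivariateGaussian 0 (A * Aᵀ)))⁻¹ * (∫ ω :
          EuclideanSpace ℝ ι, exp (-U (ω + ψ)) * (U'' (ω + ψ) (EuclideanSpace.single x (1 : ℝ)) (EuclideanSpace.single y (1 : ℝ)) * U' (ω + ψ)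
          (EuclideanSpace.single z (1 : ℝ))) ∂(multivariateGaussian 0 (A * Aᵀ))) - ((∫ ω : EuclideanSpace ℝ ι, exp (-U (ω + ψ))
          ∂(multivariateGaussian 0 (A * Aᵀ))) ^ 2)⁻¹ * ((∫ ω : EuclideanSpace ℝ ι, exp (-U (ω + ψ)) * U'' (ω + ψ) (EuclideanSpace.single x (1 : ℝ))
          (EuclideanSpace.single y (1 : ℝ)) ∂(multivariateGaussian 0 (A * Aᵀ))) * (∫ ω : EuclideanSpace ℝ ι, exp (-U (ω + ψ)) * U' (ω + ψ)
          (EuclideanSpace.single z (1 : ℝ)) ∂(multivariateGaussian 0 (A * Aᵀ))))) - ((∫ ω : EuclideanSpace ℝ ι, exp (-U (ω + ψ))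
          ∂(multivariateGaussian 0 (A * Aᵀ)))⁻¹ * (∫ ω : EuclideanSpace ℝ ι, exp (-U (ω + ψ)) * (U' (ω + ψ) (EuclideanSpace.single x (1 : ℝ)) * U''
          (ω + ψ) (EuclideanSpace.single y (1 : ℝ)) (EuclideanSpace.single z (1 : ℝ))) ∂(multivariateGaussian 0 (A * Aᵀ))) - ((∫ ω : EuclideanSpace ℝ
          ι, exp (-U (ω + ψ)) ∂(multivariateGaussian 0 (A * Aᵀ))) ^ 2)⁻¹ * ((∫ ω : EuclideanSpace ℝ ι, exp (-U (ω + ψ)) * U' (ω + ψ)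
          (EuclideanSpace.single x (1 : ℝ)) ∂(multivariateGaussian 0 (A * Aᵀ))) * (∫ ω : EuclideanSpace ℝ ι, exp (-U (ω + ψ)) * U'' (ω + ψ)
          (EuclideanSpace.single y (1 : ℝ)) (EuclideanSpace.single z (1 : ℝ)) ∂(multivariateGaussian 0 (A * Aᵀ))))) + (∫ ω : EuclideanSpace ℝ ι, exp
          (-U (ω + ψ)) ∂(multivariateGaussian 0 (A * Aᵀ)))⁻¹ * (∫ ω : EuclideanSpace ℝ ι, exp (-U (ω + ψ)) * ((U' (ω + ψ) (EuclideanSpace.single x (1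
          : ℝ)) - ((∫ ω : EuclideanSpace ℝ ι, exp (-U (ω + ψ)) ∂(multivariateGaussian 0 (A * Aᵀ)))⁻¹ * (∫ ω : EuclideanSpace ℝ ι, exp (-U (ω + ψ)) *
          U' (ω + ψ) (EuclideanSpace.single x (1 : ℝ)) ∂(multivariateGaussian 0 (A * Aᵀ))))) * (U' (ω + ψ) (EuclideanSpace.single y (1 : ℝ)) - ((∫ ω
          : EuclideanSpace ℝ ι, exp (-U (ω + ψ)) ∂(multivariateGaussian 0 (A * Aᵀ)))⁻¹ * (∫ ω : EuclideanSpace ℝ ι, exp (-U (ω + ψ)) * U' (ω + ψ)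
          (EuclideanSpace.single y (1 : ℝ)) ∂(multivariateGaussian 0 (A * Aᵀ))))) * (U' (ω + ψ) (EuclideanSpace.single z (1 : ℝ)) - ((∫ ω :
          EuclideanSpace ℝ ι, exp (-U (ω + ψ)) ∂(multivariateGaussian 0 (A * Aᵀ)))⁻¹ * (∫ ω : EuclideanSpace ℝ ι, exp (-U (ω + ψ)) * U' (ω + ψ)
          (EuclideanSpace.single z (1 : ℝ)) ∂(multivariateGaussian 0 (A * Aᵀ)))))) ∂(multivariateGaussian 0 (A * Aᵀ))) := fun y z => by
    rw [hessW_deriv_apply_centred hΓ hΓop Y hUd hU'd hU''d hU₃c hκ₀ hκ₁ ha hκ₂ hκ₃ hτ hδ hθ0 hθ1 hκθ hstab hU'b hU''b hU₃b ψ _ _ _,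
      centred_split hΓ hΓop Y hUd hU'd hU''d hU₃c hκ₀ hκ₁ ha hτ hδ hθ0 hθ1 hκθ hstab hU'b hU''b hU₃b ψ _ _ _]
  -- Step 2: the five kernel letters ((470); (469) with `y ↔ z`; (469); (473); (468) bridged by §1)
  have h1 := tilted_third_average_rowsum hΓ hΓop Y hUd hU₃c hκ₀ hτ hδ hθ0 hθ1 hκθ hstab hU₃b hU₃row ψ x
  have h2 : ∑ y, ∑ z, |((∫ ω : EuclideanSpace ℝ ι, exp (-U (ω + ψ)) ∂(multivariateGaussian 0 (A * Aᵀ)))⁻¹ * (∫ ω : EuclideanSpace ℝ ι, exp (-U (ω +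
      ψ)) * (U'' (ω + ψ) (EuclideanSpace.single x (1 : ℝ)) (EuclideanSpace.single z (1 : ℝ)) * U' (ω + ψ) (EuclideanSpace.single y (1 : ℝ)))
      ∂(multivariateGaussian 0 (A * Aᵀ))) - ((∫ ω : EuclideanSpace ℝ ι, exp (-U (ω + ψ)) ∂(multivariateGaussian 0 (A * Aᵀ))) ^ 2)⁻¹ * ((∫ ω :
      EuclideanSpace ℝ ι, exp (-U (ω + ψ)) * U'' (ω + ψ) (EuclideanSpace.single x (1 : ℝ)) (EuclideanSpace.single z (1 : ℝ)) ∂(multivariateGaussian 0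
      (A * Aᵀ))) * (∫ ω : EuclideanSpace ℝ ι, exp (-U (ω + ψ)) * U' (ω + ψ) (EuclideanSpace.single y (1 : ℝ)) ∂(multivariateGaussian 0 (A * Aᵀ)))))| ≤
      αr * k3r * (αc * hc) * (1 - γ)⁻¹ * (1 - γ')⁻¹ / (1 - lamA) := by
    rw [Finset.sum_comm]
    exact whitened_hessgrad_cov_kernel_letter hΓop Y hUd hU'd hU''d hHk hHk0 hK3 hK30 hκ₀ hτ hδ hθ1 hκθ' hκθw hstab ψ hαr hαc hhr hhc hk3r hlamA
        hlamA1 hγ hγ1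
      hγ' hγ'1 x
  have h3 := whitened_hessgrad_cov_kernel_letter hΓop Y hUd hU'd hU''d hHk hHk0 hK3 hK30 hκ₀ hτ hδ hθ1 hκθ' hκθw hstab ψ hαr hαc hhr hhc hk3r hlamA
      hlamA1 hγ
    hγ1 hγ' hγ'1 x
  have h4 := whitened_gradhess_cov_kernel_letter hΓop Y hUd hU'd hU''d hHk hHk0 hK3 hK30 hκ₀ hτ hδ hθ1 hκθ' hκθw hstab ψ hαr hαc hhr hhc hk3c hlamA
      hlamA1 hγ
    hγ1 hγ' hγ'1 x
  have h5 : ∑ y, ∑ z, |(∫ ω : EuclideanSpace ℝ ι, exp (-U (ω + ψ)) ∂(multivariateGaussian 0 (A * Aᵀ)))⁻¹ * (∫ ω : EuclideanSpace ℝ ι, exp (-U (ω +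
      ψ)) * ((U' (ω + ψ) (EuclideanSpace.single x (1 : ℝ)) - ((∫ ω : EuclideanSpace ℝ ι, exp (-U (ω + ψ)) ∂(multivariateGaussian 0 (A * Aᵀ)))⁻¹ * (∫
      ω : EuclideanSpace ℝ ι, exp (-U (ω + ψ)) * U' (ω + ψ) (EuclideanSpace.single x (1 : ℝ)) ∂(multivariateGaussian 0 (A * Aᵀ))))) * (U' (ω + ψ)
      (EuclideanSpace.single y (1 : ℝ)) - ((∫ ω : EuclideanSpace ℝ ι, exp (-U (ω + ψ)) ∂(multivariateGaussian 0 (A * Aᵀ)))⁻¹ * (∫ ω : EuclideanSpace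
      ℝ ι, exp (-U (ω + ψ)) * U' (ω + ψ) (EuclideanSpace.single y (1 : ℝ)) ∂(multivariateGaussian 0 (A * Aᵀ))))) * (U' (ω + ψ) (EuclideanSpace.single
      z (1 : ℝ)) - ((∫ ω : EuclideanSpace ℝ ι, exp (-U (ω + ψ)) ∂(multivariateGaussian 0 (A * Aᵀ)))⁻¹ * (∫ ω : EuclideanSpace ℝ ι, exp (-U (ω + ψ)) *
      U' (ω + ψ) (EuclideanSpace.single z (1 : ℝ)) ∂(multivariateGaussian 0 (A * Aᵀ)))))) ∂(multivariateGaussian 0 (A * Aᵀ)))| ≤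
      4 * Real.sqrt (5 * (κ₂ ^ 4 * γop ^ 2) / (1 - lam * γop) ^ 2 * (αθ * (1 - γθ)⁻¹ * (βθ * (1 - γθ')⁻¹) / (1 - lamA))) * S ^ 2 := by
    have h := whitened_third_cumulant_kernel_letter hΓop Y hUd hU'd hU''c hκ₀ hκ₁ ha hτ hδ hθ0 hθ1 hκθ hκθw hstab hU'b hU''b hlam hUsec hρg hHk hHk0
        ψ hlamA
      hlamA1 hθw1 hθdiag hθmul hσ0 hσθ hρ1 hρsymm hρmul hρσ hCθ hγθ1 hCθc hγθ'1 haσ hβ haσ' x hS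
    refine le_trans (le_of_eq (Finset.sum_congr rfl fun y _ => Finset.sum_congr rfl fun z _ => ?_)) h
    rw [whitened_mean_bridge hUc hU'c A ψ (EuclideanSpace.single x (1 : ℝ)), whitened_mean_bridge hUc hU'c A ψ (EuclideanSpace.single y (1 : ℝ)),
      whitened_mean_bridge hUc hU'c A ψ (EuclideanSpace.single z (1 : ℝ)), whitened_triple_bridge hUc hU'c A ψ]
  -- Step 3: assemble (`|a − b − c − d + e| ≤ Σ|·|` is the tree's `…TraceNormColdPressure.abs_sub_sub_sub_add_le`; inlined)
  have hsplit : ∀ a b c d e : ℝ, |a - b - c - d + e| ≤ |a| + |b| + |c| + |d| + |e| := fun a b c d e => by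
    have h1 := abs_add_le (a - b - c - d) e
    have h2 := abs_sub (a - b - c) d
    have h3 := abs_sub (a - b) c
    have h4 := abs_sub a b
    linarith
  simp only [hT]
  refine (Finset.sum_le_sum fun y _ => Finset.sum_le_sum fun z _ => hsplit _ _ _ _ _).trans ?_
  simp only [Finset.sum_add_distrib]
  have hsum := add_le_add (add_le_add (add_le_add (add_le_add h1 h2) h3) h4) h5
  refine hsum.trans (le_of_eq ?_)
  ring

end TheEnd

/-! ## §3. Toy -/

/-- Toy (§2's sub-additivity step in one variable): `|a + b| ≤ |a| + |b|`. -/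
example (a b : ℝ) : |a + b| ≤ |a| + |b| := abs_add_le a b

end Summit.QuantumFields.BalabanUV.T4Continuum.NE7b.SupWhitenedThirdKernelLetter

end
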